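import Literature.Computability.QuantumComplexity.KeyedOracleRun
import Literature.Computability.QuantumComplexity.QueryWeightsTruncation
import HarnessLib

/-!
# Key-averaged BBBV query magnitudes from TRUNCATED keyed runs

Topic `Literature/Computability/QuantumComplexity`; assembly of `KeyedOracleRun.lean` (the key-average identity for any
event read through the transported wires, `sum_normSq_hadamards_retarget_eq_avg_event`) and
`QueryWeightsTruncation.lean` (the `t`-th BBBV query magnitude is the probability that, after the run truncated before
the `t`-th oracle gate, its query register spells a string of `D`; `queryWeights_eq_map_oraclePositions`). Running
"Hadamards on the key wires, then the RE-TARGETED TRUNCATION" and reading the query register through the transported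
wires estimates the KEY-AVERAGE of the `t`-th query magnitude of the original algorithm relative to the keyed oracles
(the quantity BBBV's hybrid argument controls, Bennett–Bernstein–Brassard–Vazirani 1997, Def. 3.2 / Cor. 3.4, in the
averaged form used when a random oracle is replaced by a random member of a hash family, Zhandry 2012, Thm. 3.1).

* `sum_ite_queryOf_eq_queryWeight` — the Born sum over "the query register of `e` spells a string of `D`" on the basis
  input `|x 0^m⟩` is `queryWeight D e (U |x 0^m⟩)`;
* **`sum_normSq_hadamards_retarget_truncation_eq_avg_queryWeight`** — for an oracle position `(pre, k, e)` of `gs`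
  (`QueryWeightsTruncation.oraclePositions`): the probability that the transported query register spells a string of
  `D` after `(H on the key wires) ++ retarget p emb pre` on `|w⟩`, relative to `A`, equals
  `2^{-κ} Σ_key queryWeight D e (U^{A⟨c_key⟩}_{pre} |x 0^m⟩)`;
* **`sum_oraclePositions_eq_avg_sum_queryWeights`** — summed over the oracle positions: `Σ_t` of these probabilities is
  `2^{-κ} Σ_key (queryWeights A⟨c_key⟩ D gs |x 0^m⟩).sum`, the key-average of the TOTAL query magnitude of `D`.

Everything here is PROVED; no definition, no named fact.

## References

* C. H. Bennett, E. Bernstein, G. Brassard, U. Vazirani, *Strengths and weaknesses of quantum computing*, SIAM J.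
  Comput. 26 (1997) 1510–1523, Def. 3.2, Cor. 3.4 [BennettBernsteinBrassardVazirani1997].
* M. Zhandry, *Secure identity-based encryption in the quantum random oracle model*, CRYPTO 2012, Thm. 3.1 [Zhandry2012].
* M. A. Nielsen, I. L. Chuang, *Quantum Computation and Quantum Information*, CUP 2010, §2.2.8, §6.1.1 [NielsenChuang2010].
-/

noncomputable section

namespace Literature.Computability.QuantumComplexity

open Cryptography Matrix Finset

/-- The Born sum over "the query register of the placed oracle gate `e` spells a string of `D`", on the basis input
`|x 0^m⟩` of a circuit `C`, is BBBV's query magnitude of the output state. [cite: BennettBernsteinBrassardVazirani1997, Def. 3.2] -/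
theorem sum_ite_queryOf_eq_queryWeight {G : QGateSet} {n m k : ℕ} (B : Language Bool) (C : QCircuit G (n + m))
    (x : QReg n) (D : Set (List Bool)) [DecidablePred (· ∈ D)] (e : Fin (k + 1) ↪ Fin (n + m)) :
    (∑ u : QReg (n + m), if queryOf e u ∈ D then ‖C.toMatrix B u (padInput x m)‖ ^ 2 else 0) =
      queryWeight D e (C.toMatrix B *ᵥ basisState (padInput x m)) := by
  classical
  unfold queryWeight
  refine Finset.sum_congr rfl fun u _ => ?_
  rw [mulVec_basisState]
  congr 1

/-- **Key-averaged query magnitude from a truncated keyed run.** Setting of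
`sum_normSq_hadamards_retarget_eq_avg_acceptProb` (prefix wires `p` disjoint from the transported wires `emb`, key wires
`t.trans p`, big basis input `w` with `w ∘ emb = x 0^m` and `0` on the key wires). For a gate list `pre` (a truncation
of the algorithm) and a placed oracle gate `e` of the small register: the probability that the transported query
register of `e` spells a string of `D` after `(H on the key wires) ++ retarget p emb pre`, relative to `A`, is
`2^{-κ} Σ_key queryWeight D e (U^{A⟨c_key⟩}_{pre} |x 0^m⟩)`.
[cite: Zhandry2012, Thm. 3.1] [cite: BennettBernsteinBrassardVazirani1997, Def. 3.2] -/
theorem sum_normSq_hadamards_retarget_truncation_eq_avg_queryWeight {n m N P κ k : ℕ}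
    (pre : List (QGate cliffordT (n + m))) (e : Fin (k + 1) ↪ Fin (n + m))
    (p : Fin P ↪ Fin N) (emb : Fin (n + m) ↪ Fin N) (hdisj : ∀ a i, p a ≠ emb i)
    (t : Fin κ ↪ Fin P) (A : Language Bool) (w : QReg N) (x : QReg n) (hwx : w ∘ emb = padInput x m)
    (hw0 : ∀ j, w ((t.trans p) j) = false) (D : Set (List Bool)) [DecidablePred (· ∈ D)] :
    (∑ y ∈ univ.filter (fun y : QReg N => queryOf e (y ∘ emb) ∈ D),
        ‖((⟨(List.ofFn (t.trans p)).map hOn ++ retarget p emb hdisj pre⟩ : QCircuit cliffordT N).toMatrix A *ᵥ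
          basisState w) y‖ ^ 2) =
      (1 / 2 : ℝ) ^ κ * ∑ key : QReg κ,
        queryWeight D e ((⟨pre⟩ : QCircuit cliffordT (n + m)).toMatrix
          (prefixSlice A (List.ofFn (assignKey (t.trans p) w key ∘ p))) *ᵥ basisState (padInput x m)) := by
  classical
  rw [sum_normSq_hadamards_retarget_eq_avg_event pre p emb hdisj t A w x hwx hw0 (fun u => queryOf e u ∈ D)]
  congr 1
  refine Finset.sum_congr rfl fun key _ => ?_
  exact sum_ite_queryOf_eq_queryWeight _ _ x D e

/-- Interchanging a list sum with a finite sum. [folklore] -/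
private theorem list_sum_map_finset_sum {α β : Type*} [Fintype β] (L : List α) (f : α → β → ℝ) :
    (L.map fun q => ∑ b, f q b).sum = ∑ b, (L.map fun q => f q b).sum := by
  induction L with
  | nil => simp
  | cons a L ih => simp only [List.map_cons, List.sum_cons, ih, Finset.sum_add_distrib]

/-- **Summed over the oracle positions: the key-average of the total query magnitude.** With `oraclePositions gs`
listing the truncations of `gs` before its oracle gates together with their wires, the sum over these positions of the
truncated-run probabilities above equals `2^{-κ} Σ_key (queryWeights A⟨c_key⟩ D gs |x 0^m⟩).sum`.
[cite: BennettBernsteinBrassardVazirani1997, Cor. 3.4 (Σ_i q_y(|φ_i⟩))] [cite: Zhandry2012, Thm. 3.1] -/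
theorem sum_oraclePositions_eq_avg_sum_queryWeights {n m N P κ : ℕ} (gs : List (QGate cliffordT (n + m)))
    (p : Fin P ↪ Fin N) (emb : Fin (n + m) ↪ Fin N) (hdisj : ∀ a i, p a ≠ emb i)
    (t : Fin κ ↪ Fin P) (A : Language Bool) (w : QReg N) (x : QReg n) (hwx : w ∘ emb = padInput x m)
    (hw0 : ∀ j, w ((t.trans p) j) = false) (D : Set (List Bool)) [DecidablePred (· ∈ D)] :
    ((oraclePositions gs).map fun q =>
        ∑ y ∈ univ.filter (fun y : QReg N => queryOf q.2.2 (y ∘ emb) ∈ D),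
          ‖((⟨(List.ofFn (t.trans p)).map hOn ++ retarget p emb hdisj q.1⟩ : QCircuit cliffordT N).toMatrix A *ᵥ
            basisState w) y‖ ^ 2).sum =
      (1 / 2 : ℝ) ^ κ * ∑ key : QReg κ,
        (queryWeights (prefixSlice A (List.ofFn (assignKey (t.trans p) w key ∘ p))) D gs
          (basisState (padInput x m))).sum := by
  classical
  -- rewrite every position by the truncated-run identity
  have hmap : ((oraclePositions gs).map fun q =>
        ∑ y ∈ univ.filter (fun y : QReg N => queryOf q.2.2 (y ∘ emb) ∈ D),
          ‖((⟨(List.ofFn (t.trans p)).map hOn ++ retarget p emb hdisj q.1⟩ : QCircuit cliffordT N).toMatrix A *ᵥ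
            basisState w) y‖ ^ 2) =
      (oraclePositions gs).map fun q => (1 / 2 : ℝ) ^ κ * ∑ key : QReg κ,
        queryWeight D q.2.2 ((⟨q.1⟩ : QCircuit cliffordT (n + m)).toMatrix
          (prefixSlice A (List.ofFn (assignKey (t.trans p) w key ∘ p))) *ᵥ basisState (padInput x m)) := by
    refine List.map_congr_left fun q _ => ?_
    exact sum_normSq_hadamards_retarget_truncation_eq_avg_queryWeight q.1 q.2.2 p emb hdisj t A w x hwx hw0 D
  rw [hmap, List.sum_map_mul_left, list_sum_map_finset_sum]
  congr 1
  refine Finset.sum_congr rfl fun key _ => ?_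
  rw [sum_queryWeights_eq_sum_oraclePositions]

end Literature.Computability.QuantumComplexity

end
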